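import Literature.NumberTheory.EllipticCurves.KramerTunnell1982.UnramifiedNormIndex
import Literature.NumberTheory.EllipticCurves.Tamagawa
import HarnessLib

/-!
# Cell `bsd-f1-sign2`, DESC-NI: the EXACT unramified quadratic norm index by Kodaira type on the `*`-types (completes the parity of Kramer–Tunnell 1982 Lemma 6.1) — typed candidate `Prop` (-desc g16, MEMO-desc §24-add2; D-imc-45 «unr» leg)

PORT (cell `bsd-f1-sign2`, seat `-ty` g12) of -desc g16's sketch `MEMO-desc-data/g16/lean/SketchG16NormIndex.lean` e98f43af44be78cb (MEMO-desc §24-add2 l.1865, memo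
e2a3f04ca805b792; -desc: farm rc 0 · 0 err · 0 warn · 0 sorry, BC7 CLEAN 9bde949422143cc0; CANDIDATES-delta DESC v24.1, INBOX 2026-08-28T17:07:40Z).  Typer edits =
this header and the three cite tags in the decl docstring (REF2 v40-add1 §C(3)); the `Prop` VERBATIM, a PLAIN `def` (nothing asserted).  BC5 witness =
ENGINE 2 (pure python `MEMO-desc-data/g16/c5_iunr.py` 84e7dda56544ef64 → `c5_iunr.out` da6ec5b24d8e6286) on the 6 643 X5 members (kod₂, c₂), F = ℚ₂, K = ℚ₂(√5):
i ∈ {0: 4 525, 1: 1 797, 2: 321}; additive potentially-good members nonzero exactly on III ∪ III* = 271 of 1 511 (all 233 I₀* members have c ≤ 2 ⇒ 0); parity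
against the tree fact `KramerTunnell1982.lemma61_unramifiedNormIndex`: 0 violations.  ENGINE 1 (D-desc-61, PARI norm index on the same members, «one mismatch kills
DESC-NI») was asked of -data, a seat vacant since g3 — OUTSTANDING; the second, methodologically different check that exists is REF1 §131's recomputation of every
table entry from the G-module (Φ(k̄), Frob_F) (below).  Cheapest falsifier (-desc): any I₁* member with c₂ = 2 over ℚ₂(√5), predicted i = 1.  Why novel (-desc):
the tree fact and the printed Lemma 6.1 record only the parity i ≡ n − 1 (mod 2); the closed c_F-indexed values on I₀*, I_v* are «not recorded» (tree file
`Literature/NumberTheory/EllipticCurves/KramerTunnell1982/UnramifiedNormIndex.lean` l.75) — REF2 grades the completion KNOWN (the paper's PROOF yields the group).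
REF1 §131 (refuter-bsd-f1-sign2-ref1 g11, D-desc-60, `HOME/REF1-AUDIT-v1.md` l.2533, evidence `REF1-data/b131/`, 2026-08-28T18:14:42Z): «DESC-NI
(`UnramifiedQuadraticNormIndexStarTypes`: i(K⁄F) = dim E(F)⁄N E(K) = dim Ĥ⁰(C₂, Φ_E(k_K)[2^∞]) for K⁄F unramified quadratic, with the closed table 0 | 1 | «2 if
c_F = 4 else 0») CERTIFIED (Lang–Mazur: E₁(K) and Ẽ⁰_{ns}(k_K) are cohomologically trivial for unramified K⁄F, E(K)⁄E⁰(K) = Φ(k_K) by Hensel, so Ĥ^i(C₂, E(K)) ≅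
Ĥ^i(C₂, Φ(k_K)) = Ĥ^i(C₂, Φ(k_K)[2^∞]); REF1 recomputes every entry from the G-MODULE (Φ(k̄), Frob_F) rather than from the table — I_n: ℤ⁄n with Frob = ±1;
I₀*, I*_{even}: (ℤ⁄2)² with Frob ∈ {1, transposition, 3-cycle (I₀* only)} read off c_F ∈ {4, 2, 1}; I*_{odd}: ℤ⁄4 with Frob = ±1; III, III*: ℤ⁄2; II, II*, IV,
IV*: 2-part 0 — obtaining M^G⁄NM of dimension 0, 1, 2 exactly as tabulated (the one non-obvious entry: (ℤ⁄2)² with σ a transposition has M^G = ⟨e₁+e₂⟩ = NM,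
index 0, although dim Φ(k_F)⁄2 = 1 — the F-rational far component IS a norm), with Ĥ⁰ = Ĥ¹ (Herbrand) checked entry-wise); REF1's module table = -desc's closed
table entry by entry; the dictionary consequence for D-imc-45 («unr» column = dim Ĥ⁰(C₂, Φ[2^∞]), 0 for good reduction; SPLIT ⇒ 0) ✓.  KILLED: none.  PARTITION
moved: none.  Beyond-print theorem: no (bookkeeping over Lang–Mazur; new as a statement, not as technique — REF1 agrees with -desc's own label).»
REF2 v37 §1.6 (refuter-bsd-f1-sign2-ref2 g37, `HOME/REF2-PLACEMENT-v37.md` 6c8d80a74c8eac64, 2026-08-28T17:45:10Z), verbatim in substance: «DESC-NI KNOWN IN PRINT: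
Kramer–Tunnell, Elliptic curves and local ε-factors, Compositio 46 (1982) §6, p. 327 «N: E⁰(K) → E⁰(F) is surjective [Lang]. Let X be the 2-Sylow subgroup of
E(K)⁄E⁰(K), G = Gal(K⁄F) … E(F)⁄NE(K) ≅ Ĥ⁰(G, X)»; LEMMA 6.1, whose PROOF computes Ĥ⁰(G, X) type by type (I₀, I_ν ν odd, II, II*, IV, IV*: 0; III, III*: 1;
I_ν ν even: 1; I*_ν: X of order «1 or 4», decided by the Frobenius action on the components); Thm 6.2 (the parity i ≡ δ) + Kramer, Trans. AMS 264 (1981) p. 124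
(«If K over F is unramified and E has good reduction then i(K⁄F) = 0 according to [8, Corollary 4.2]» = Mazur 1972) and Prop. 2(a) (twisted Tate curves: i = 0 or
1 by the parity of v(Δ)).  The TREE fact records only the parity; the PAPER's proof yields the group, i.e. -desc's table except that the split of I₀*, I*_{2m} by
c_F ∈ {1, 2, 4} is written there as a Frobenius-action dichotomy rather than «2 if c_F = 4 else 0» — elementary bookkeeping.  What is the cell's: the closed
c_F-indexed table and the two-engine census.  Grade KNOWN; beyond-print no; cite KT82 §6 (proof of Lemma 6.1) as the source of the statement, not only Thm 6.2,
7.6.» (REF2 v37 §1.8 last sentence and REF2 v40-add1 §C(3) cite slots: see the decl docstring.)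
[cite: KramerTunnell1982, §6, proof of Lemma 6.1] [cite: Kramer1981, §2, Props. 1, 2(a)] [cite: SilvermanATAEC1994, IV.§9, Tate's algorithm 9.4 and Table 4.1]
PARTITION: none moved; beyond-print theorem: no (KNOWN, REF2 v37 §1.6); BSD not proved; 23715 not closed.

## The sketch's own summary (verbatim)

# -desc g16 §24-add2 — exact UNRAMIFIED quadratic norm indices by Kodaira type (completes
# Kramer–Tunnell 1982 Lemma 6.1 beyond its parity; answer to D-imc-45 «unr» leg, ENGINE 2 = theory)

For `K/F` an unramified quadratic extension of nonarchimedean local fields (residue characteristic `2`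
included), `G = Gal(K/F) = ⟨σ⟩`, Lang's theorem and the cohomological triviality of the identity
component give `E(F)/N E(K) ≅ Ĥ⁰(G, Φ_E(k_K)[2^∞])` (the method of [KramerTunnell1982, §6 proof of
Lemma 6.1]; [Kramer1981, §2 p. 123 "[8, Corollary 4.2]"] = Mazur 1972). Reading Tate's table with the
Frobenius action on `Φ(k̄)` gives the EXACT index `2^{i(K/F)}`:
`I₀, II, II*, IV, IV*, I_v (v odd) ↦ 1` (printed, `lemma61_unramifiedNormIndex` clause (ii));
`I_v (v even > 0) ↦ 2` ([Kramer1981, Props 1, 2(a)]); `III, III* ↦ 2` (printed in the proof);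
`I₀* ↦ 4` if `c_F = 4`, else `1`; `I_v* (v odd) ↦ 2`; `I_v* (v even > 0) ↦ 4` if `c_F = 4`, else `1`
— the last three lines are NOT printed in [KramerTunnell1982] ("not recorded" in the tree file) and
are the content of this row. Consistent with the printed parity `i ≡ n − 1 (mod 2)` in every case.
Census (pure python `c5_iunr.py` on X5-AT2-MEMBERS-v1.2.tsv, `F = ℚ₂`, `K = ℚ₂(√5)`): 6 643 members,
predicted `i ∈ {0: 4 525, 1: 1 797, 2: 321}`; parity check against Lemma 6.1: 0 violations.
-/

noncomputable section

open ValuativeRel Field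
open Literature.NumberTheory.GaloisRepresentations.IsNonarchimedeanLocalField
open Literature.NumberTheory.DiophantineGeometry
open Literature.NumberTheory.EllipticCurves.KramerTunnell1982

namespace Summit.BirchSwinnertonDyer.Rank1Residual.F1Sign2

open scoped Classical in
/-- **DESC-NI (unramified quadratic norm index, exact values on the `*`-types).** Setting of
`lemma61_unramifiedNormIndex`: `F` a nonarchimedean local field, `E/F` elliptic, `K' ≤ maxUnramified F`
with `[K' : F] = 2`, `σ ≠ 1`; `c_F = E.localTamagawaNumber 𝒪[F]`. Then the index
`#(E(F)/N E(K')) = (normSubgroup E K' σ).relIndex (fixedSubgroup E K' σ)` is: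
`III, III* ↦ 2`; `I₀* ↦ 4` if `c_F = 4` and `1` otherwise; `I_v*` (`v` odd) `↦ 2`;
`I_v*` (`v` even, `v > 0`) `↦ 4` if `c_F = 4` and `1` otherwise.
Why it might fail: only through a junk case of the carriers (`relIndex = 0` for an infinite index is
excluded by finiteness of `Φ`); the group-cohomology computation is a finite check per type.
Sources: [cite: KramerTunnell1982, §6, proof of Lemma 6.1] [cite: Kramer1981, §2, Props. 1, 2(a)]
[cite: SilvermanATAEC1994, IV.§9, Tate's algorithm 9.4 and Table 4.1] (REF2 v37 §1.6, v40-add1 §C(3)). -/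
def UnramifiedQuadraticNormIndexStarTypes : Prop :=
  ∀ (F : Type) [Field F] [ValuativeRel F] [TopologicalSpace F] [IsNonarchimedeanLocalField F]
    (E : WeierstrassCurve F) [E.IsElliptic]
    (K' : IntermediateField F (AlgebraicClosure F)) (_hK' : K' ≤ maxUnramified F)
    (_h2 : Module.finrank F K' = 2) (σ : K' ≃ₐ[F] K') (_hσ : σ ≠ 1),
    ((E.kodairaSymbol 𝒪[F] = .III ∨ E.kodairaSymbol 𝒪[F] = .IIIstar) →
        (normSubgroup E K' σ).relIndex (fixedSubgroup E K' σ) = 2) ∧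
    (E.kodairaSymbol 𝒪[F] = .Istar 0 →
        (E.localTamagawaNumber 𝒪[F] = 4 → (normSubgroup E K' σ).relIndex (fixedSubgroup E K' σ) = 4) ∧
        (E.localTamagawaNumber 𝒪[F] ≠ 4 → (normSubgroup E K' σ).relIndex (fixedSubgroup E K' σ) = 1)) ∧
    (∀ v : ℕ, E.kodairaSymbol 𝒪[F] = .Istar v → Odd v →
        (normSubgroup E K' σ).relIndex (fixedSubgroup E K' σ) = 2) ∧
    (∀ v : ℕ, E.kodairaSymbol 𝒪[F] = .Istar v → Even v → 0 < v →
        (E.localTamagawaNumber 𝒪[F] = 4 → (normSubgroup E K' σ).relIndex (fixedSubgroup E K' σ) = 4) ∧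
        (E.localTamagawaNumber 𝒪[F] ≠ 4 → (normSubgroup E K' σ).relIndex (fixedSubgroup E K' σ) = 1))

end Summit.BirchSwinnertonDyer.Rank1Residual.F1Sign2

end
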